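import Literature.AlgebraicGeometry.Resolution.BlowupChartRegular
import Literature.AlgebraicGeometry.Resolution.RsopMonomialIdeals
import Literature.AlgebraicGeometry.Resolution.MvPolynomialKillVars
import Mathlib.RingTheory.Regular.Flat
import Mathlib.RingTheory.KrullDimension.Regular
import HarnessLib

/-!
# The blow-up of a regular local ring along part of a regular system of parameters: local rings of the chart

Topic: `Literature/AlgebraicGeometry/Resolution`. Node F6 (algebra) of the decomposition of
`DeJong1996NormalCrossingsBlowup` (de Jong 1996, 2.4; `NormalCrossingsStrictification.lean`):
the local structure, at a point over the closed point, of the blowing up of a regular local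
ring `R` along the ideal `I = (c₁, …, c_n)` generated by PART of a regular system of parameters
`(c₁, …, c_n, w₁, …, w_l)` of `R`. On the chart `D₊(cᵢ t) = Spec B`, `B = (R[It])_{(cᵢt)}`
(`AffineBlowup.lean`, `BlowupChartQuasiRegular.lean`, `BlowupChartRegular.lean`), with
`e_j = (c_j t)/(cᵢ t)` (`φ(c_j) = φ(cᵢ) e_j`), let `𝔓 ⊂ B` be a prime lying over `𝔪_R` and
`L = B_𝔓`. Then

**Theorem** (`isRsopPart_chartFamily_reesChart`). For every injective enumeration `jJ` of
indices `j ≠ i` with `e_j ∈ 𝔓`, the family `(cᵢ, (e_{jJ k})_k, w₁, …, w_l)` is part of a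
regular system of parameters of `L`; in particular `L` is a regular local ring
(`isRegularLocalRing_chart`). (The `e_j ∉ 𝔓` are units of `L`, `IsLocalization.map_units`.)

This is the computation behind "blow up `V(x₁, …, x_m)` inside the normal crossings divisor
`V(x₁ ⋯ x_r)`: in the chart `x_j = xᵢ x_j'` the total transform is `xᵢ^m ∏ x_j' ∏_{k>m} x_k`,
again monomial in a regular system of parameters".

Proof. `dim L/(ζ) + |ζ| = dim L` for the displayed family `ζ`
(`ringKrullDim_quot_chartFamily_add`), because `ζ` is a regular sequence
(`isRegular_chartFamily`): `cᵢ` is a non-zero-divisor of `B` (Stacks 0804), and modulo `cᵢ` the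
rest is the image, in the flat `(R/I)[T]`-algebra `L/(cᵢ)` (a localisation of
`B/(cᵢ) ≅ (R/I)[T_j : j ≠ i]`, `chartQuotEquiv`, Stacks 0BIQ), of the weakly regular sequence
"the variables `T_J`, then the regular system of parameters `w̄` of the regular local ring `R/I`"
(`isWeaklyRegular_X_append_C`; distinct variables are weakly regular by
`MvPolynomialKillVars.lean`, and `w̄` stays regular on the flat `R/I`-module
`(R/I)[T]/(T_J) ≅ (R/I)[T_j : j ∉ J]`). And `L/(ζ)` is a localisation of
`B/(cᵢ, e_J, w) ≅ (R/𝔪)[T_j : j ∉ J]`, a regular ring (`isRegularRing_quot_chartIdeal`,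
`isRegularLocalRing_quot_map_of_isRegularRing`). So the criterion
`IsRsopPart.of_isRegularLocalRing_quotient` (`RsopMonomialIdeals.lean`) applies.

To keep instance search light, everything from `quotBarAlgebra` on is proved for ABSTRACT chart
data `(A, ψ : R → A, u, ε : (R/I)[T] ≅ A/(ψ cᵢ), 𝔓, L)` with `L` any localisation of `A` at
`𝔓` (`IsLocalization.AtPrime L 𝔓`), and specialised to the Rees chart at the end; node F7 applies
it with `L = 𝒪_{X',x'}`, a stalk of the blow-up. Everything is PROVED; statements are
[folklore] unless a locator is given.

## Sources

* A. J. de Jong, *Smoothness, semi-stability and alterations*, Publ. Math. IHÉS 83 (1996), 2.4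
  (p. 55) and 4.26–4.27.
* H. Matsumura, *Commutative Ring Theory* (1986), Thms. 14.2, 17.4, 19.3. [Matsumura1987]
* The Stacks Project, Tags 0804, 0BIQ, 00NQ.
-/

noncomputable section

open IsLocalRing Polynomial HomogeneousLocalization
open scoped Pointwise

namespace Literature.AlgebraicGeometry.Resolution

universe u

variable {R : Type u} [CommRing R] {n : ℕ} (c : Fin n → R) (i : Fin n)

/-! ## The chart ring, its structure map and generators (abbreviations) -/

/-- **The chart ring** `B = (R[It])_{(cᵢ t)}` of `Bl_I(Spec R) = Proj R[It]`, `I = (c₁, …, c_n)`,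
at the generator `cᵢ` (`AffineBlowup.lean`). [cite: StacksProject, Tag 0804] -/
abbrev chartRing : Type u :=
  HomogeneousLocalization.Away (reesGrading (Ideal.span (Set.range c)))
    (reesT (c i) (Ideal.mem_span_range_self (f := c) (x := i)))

/-- The structure map `φ : R → B`, `r ↦ r/1` (`reesChartBase`). [cite: StacksProject, Tag 0804] -/
abbrev chartBase : R →+* chartRing c i :=
  reesChartBase (c i) (Ideal.mem_span_range_self (f := c) (x := i))

/-- The generators `e_j = (c_j t)/(cᵢ t)` of the chart ring (`φ(c_j) = φ(cᵢ) e_j`).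
[cite: StacksProject, Tag 0804] -/
abbrev chartGen (j : Fin n) : chartRing c i :=
  HomogeneousLocalization.Away.mk (reesGrading (Ideal.span (Set.range c)))
    (reesT_mem (c i) (Ideal.mem_span_range_self (f := c) (x := i))) 1
    (reesT (c j) (Ideal.mem_span_range_self (f := c) (x := j))) (reesT_mem_one_smul c j)

local notation3 "I" => Ideal.span (Set.range c)
local notation3 "B" => chartRing c i
local notation3 "φ" => chartBase c i
local notation3 "e[" j "]" => chartGen c i j
local notation3 "P" => MvPolynomial {j : Fin n // j ≠ i} (R ⧸ I)
local notation3 "K" => Ideal.span {φ (c i)}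

/-! ## The chart modulo the exceptional divisor, as an explicit isomorphism -/

/-- `R/I → B/(cᵢ)`, induced by `φ : R → B` (`φ(I) ⊆ (cᵢ)`). [folklore] -/
def quotToChartQuot : R ⧸ I →+* B ⧸ K :=
  Ideal.Quotient.lift I ((Ideal.Quotient.mk K).comp φ) fun r hr => by
    rw [RingHom.comp_apply, Ideal.Quotient.eq_zero_iff_mem]
    exact reesChartBase_mem_span_of_mem c i hr

/-- `quotToChartQuot` on classes. [folklore] -/
theorem quotToChartQuot_mk (r : R) :
    quotToChartQuot c i (Ideal.Quotient.mk I r) = Ideal.Quotient.mk K (φ r) :=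
  rfl

/-- **The chart map `(R/I)[T_j : j ≠ i] → B/(cᵢ)`**, `T_j ↦ e_j = (c_j t)/(cᵢ t)`. [folklore] -/
def chartQuotMap : P →+* B ⧸ K :=
  MvPolynomial.eval₂Hom (quotToChartQuot c i) fun j => Ideal.Quotient.mk K e[j.1]

/-- `chartQuotMap` on constants. [folklore] -/
theorem chartQuotMap_C (r : R) :
    chartQuotMap c i (MvPolynomial.C (Ideal.Quotient.mk I r)) = Ideal.Quotient.mk K (φ r) := by
  rw [chartQuotMap, MvPolynomial.eval₂Hom_C, quotToChartQuot_mk]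

/-- `chartQuotMap` on variables. [folklore] -/
theorem chartQuotMap_X (j : {j : Fin n // j ≠ i}) :
    chartQuotMap c i (MvPolynomial.X j) = Ideal.Quotient.mk K e[j.1] := by
  rw [chartQuotMap, MvPolynomial.eval₂Hom_X']

/-- `chartQuotMap ∘ (reduce coefficients mod I) = (mod cᵢ) ∘ (T ↦ e)`. [folklore] -/
theorem chartQuotMap_comp_map :
    (chartQuotMap c i).comp (MvPolynomial.map (Ideal.Quotient.mk I)) =
      (Ideal.Quotient.mk K).comp
        (MvPolynomial.eval₂Hom φ fun j : {j : Fin n // j ≠ i} => e[j.1]) := by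
  refine MvPolynomial.ringHom_ext (fun r => ?_) (fun j => ?_)
  · rw [RingHom.comp_apply, MvPolynomial.map_C, chartQuotMap_C, RingHom.comp_apply,
      MvPolynomial.eval₂Hom_C]
  · rw [RingHom.comp_apply, MvPolynomial.map_X, chartQuotMap_X, RingHom.comp_apply,
      MvPolynomial.eval₂Hom_X']

/-- **`chartQuotMap` is bijective** for `c` quasi-regular: it is surjective as `B` is generated by
the `e_j` (`quotient_comp_eval₂Hom_surjective`), and injective because the relations modulo
`cᵢ` are exactly `I · R[T]` (`ker_quotient_comp_eval₂Hom_eq`).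
[cite: StacksProject, Tag 0BIQ] -/
theorem chartQuotMap_bijective (hc : IsQuasiRegular c) : Function.Bijective (chartQuotMap c i) := by
  have hsurj : Function.Surjective (MvPolynomial.map (σ := {j : Fin n // j ≠ i})
      (Ideal.Quotient.mk I)) := MvPolynomial.map_surjective _ Ideal.Quotient.mk_surjective
  constructor
  · rw [injective_iff_map_eq_zero]
    intro p hp
    obtain ⟨p₀, rfl⟩ := hsurj p
    have h1 : ((Ideal.Quotient.mk K).comp
        (MvPolynomial.eval₂Hom φ fun j : {j : Fin n // j ≠ i} => e[j.1])) p₀ = 0 := by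
      rw [← chartQuotMap_comp_map, RingHom.comp_apply, hp]
    rw [← RingHom.mem_ker, ker_quotient_comp_eval₂Hom_eq c i hc] at h1
    rw [← RingHom.mem_ker, MvPolynomial.ker_map, Ideal.mk_ker] at *
    exact h1
  · intro b
    obtain ⟨p₀, hp₀⟩ := quotient_comp_eval₂Hom_surjective c i b
    refine ⟨MvPolynomial.map (Ideal.Quotient.mk I) p₀, ?_⟩
    rw [← RingHom.comp_apply, chartQuotMap_comp_map, hp₀]

/-- **`(R/I)[T_j : j ≠ i] ≅ B/(cᵢ)`** explicitly (for `c` quasi-regular).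
[cite: StacksProject, Tag 0BIQ] -/
def chartQuotEquiv (hc : IsQuasiRegular c) : P ≃+* B ⧸ K :=
  RingEquiv.ofBijective (chartQuotMap c i) (chartQuotMap_bijective c i hc)

/-- `chartQuotEquiv` is `chartQuotMap`. [folklore] -/
theorem chartQuotEquiv_apply (hc : IsQuasiRegular c) (p : P) :
    chartQuotEquiv c i hc p = chartQuotMap c i p :=
  rfl

/-! ## Transport of weakly regular sequences along ring isomorphisms -/

/-- A ring isomorphism carries weakly regular sequences (of a ring on itself) to weakly regular
sequences. [folklore] -/
theorem RingEquiv.isWeaklyRegular_map_iff {S S' : Type*} [CommRing S] [CommRing S']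
    (ε : S ≃+* S') (rs : List S) :
    RingTheory.Sequence.IsWeaklyRegular S' (rs.map ε) ↔ RingTheory.Sequence.IsWeaklyRegular S rs := by
  symm
  refine AddEquiv.isWeaklyRegular_congr (e := ε.toAddEquiv) ?_
  refine List.forall₂_map_right_iff.mpr (List.forall₂_same.mpr fun r _ x => ?_)
  change ε (r * x) = ε r * ε x
  exact map_mul ε r x

/-! ## The regular local ring `R` with its regular system of parameters `(c, w)` -/

section Rsop

variable [IsRegularLocalRing R] {l : ℕ} (w : Fin l → R)
  (hz : Ideal.span (Set.range (Fin.append c w)) = maximalIdeal R)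
  (hd : (maximalIdeal R).spanFinrank = n + l)

include hz hd in
/-- The centre coordinates are part of a regular system of parameters. [folklore] -/
theorem isRsopPart_centre : IsRsopPart c := by
  have := isRsopPart_comp_of_rsop hd (Fin.append c w) hz (Fin.castAdd l) (Fin.castAdd_injective n l)
  rwa [show Fin.append c w ∘ Fin.castAdd l = c from funext fun j => by simp] at this

include hz hd in
/-- The centre coordinates form a quasi-regular sequence. [cite: Matsumura1987, Thm. 16.2 (i)] -/
theorem isQuasiRegular_centre : IsQuasiRegular c := by
  have := isQuasiRegular_rsop_comp hd (Fin.append c w) hz (Fin.castAdd l) (Fin.castAdd_injective n l)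
  rwa [show Fin.append c w ∘ Fin.castAdd l = c from funext fun j => by simp] at this

include hz hd in
/-- `R/I` is a regular local ring (quotient by part of a regular system of parameters).
[cite: Matsumura1987, Thm. 14.2] -/
theorem isRegularLocalRing_quot_centre : IsRegularLocalRing (R ⧸ I) :=
  (isRsopPart_centre c w hz hd).isRegularLocalRing_quotient

include hz in
/-- The images `w̄` of the `w`'s generate the maximal ideal of `R/I`. [folklore] -/
theorem ofList_ofFn_mk_w [Nontrivial (R ⧸ I)] :
    haveI := IsLocalRing.of_surjective' (Ideal.Quotient.mk I) Ideal.Quotient.mk_surjective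
    Ideal.ofList (List.ofFn fun k => Ideal.Quotient.mk I (w k)) = maximalIdeal (R ⧸ I) := by
  haveI := IsLocalRing.of_surjective' (Ideal.Quotient.mk I) Ideal.Quotient.mk_surjective
  rw [maximalIdeal_quotient_eq_map I, ← hz, Ideal.map_span, Ideal.ofList]
  apply le_antisymm
  · rw [Ideal.span_le]
    intro r hr
    rw [Set.mem_setOf_eq, List.mem_ofFn] at hr
    obtain ⟨k, rfl⟩ := hr
    refine Ideal.subset_span ⟨Fin.append c w (Fin.natAdd n k), ⟨Fin.natAdd n k, rfl⟩, ?_⟩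
    simp
  · rw [Ideal.span_le]
    rintro _ ⟨_, ⟨a, rfl⟩, rfl⟩
    induction a using Fin.addCases with
    | left j =>
      have hj : c j ∈ Ideal.span (Set.range c) := Ideal.subset_span (Set.mem_range_self j)
      rw [Fin.append_left, SetLike.mem_coe, Ideal.Quotient.eq_zero_iff_mem.mpr hj]
      exact Ideal.zero_mem _
    | right k =>
      rw [Fin.append_right]
      refine Ideal.subset_span ?_
      rw [Set.mem_setOf_eq, List.mem_ofFn]
      exact ⟨k, rfl⟩

include hz hd in
/-- `dim R/I = l`. [cite: Matsumura1987, Thm. 14.2] -/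
theorem ringKrullDim_quot_centre : ringKrullDim (R ⧸ I) = l := by
  have h1 := (isRsopPart_centre c w hz hd).ringKrullDim_quotient_add
  have h2 : ringKrullDim R = (n + l : ℕ) := by
    rw [← IsRegularLocalRing.spanFinrank_maximalIdeal, hd]
  haveI := isRegularLocalRing_quot_centre c w hz hd
  obtain ⟨m, hm⟩ := ringKrullDim_eq_nat (R ⧸ I)
  rw [hm, h2] at h1
  rw [hm]
  have h3 : ((m + n : ℕ) : WithBot ℕ∞) = ((n + l : ℕ) : WithBot ℕ∞) := by push_cast at h1 ⊢; exact h1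
  have := Nat.cast_injective (R := WithBot ℕ∞) h3
  have hml : m = l := by omega
  rw [hml]

include hz hd in
/-- **`w̄` is an `R/I`-regular sequence** (a regular system of parameters of the regular local
ring `R/I`). [cite: Matsumura1987, Thms. 14.2, 17.8] -/
theorem isRegular_ofFn_mk_w :
    RingTheory.Sequence.IsRegular (R ⧸ I) (List.ofFn fun k => Ideal.Quotient.mk I (w k)) := by
  haveI := isRegularLocalRing_quot_centre c w hz hd
  refine isRegular_of_span_eq_maximalIdeal (R ⧸ I) _ ?_ ?_
  · have := ofList_ofFn_mk_w c w hz
    exact this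
  · rw [List.length_ofFn, ringKrullDim_quot_centre c w hz hd]

include hz hd in
/-- **The weakly regular sequence on `(R/I)[T_j : j ≠ i]`**: distinct variables `T_{j₁}, …, T_{j_a}`
followed by the constants `w̄₁, …, w̄_l` (the variables are weakly regular on any polynomial
ring; modulo them, the `w̄`'s are the images of an `R/I`-regular sequence in the flat
`R/I`-algebra `(R/I)[T_j : j ∉ J]`). [folklore] -/
theorem isWeaklyRegular_X_append_C {a : ℕ} (jJ : Fin a → {j : Fin n // j ≠ i})
    (hjJ : Function.Injective jJ) :
    RingTheory.Sequence.IsWeaklyRegular P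
      ((List.ofFn fun k => (MvPolynomial.X (jJ k) : P)) ++
        List.ofFn fun k => (MvPolynomial.C (Ideal.Quotient.mk I (w k)) : P)) := by
  classical
  haveI := isRegularLocalRing_quot_centre c w hz hd
  rw [RingTheory.Sequence.isWeaklyRegular_append_iff]
  constructor
  · -- the variables
    have := MvPolynomial.isWeaklyRegular_map_X (R := R ⧸ I) (List.ofFn jJ)
      (List.nodup_ofFn.mpr hjJ)
    rwa [List.map_ofFn] at this
  · -- modulo the variables: transport from `(R/I)[T_j : j ∉ J]`
    set sJ : Set {j : Fin n // j ≠ i} := Set.range jJ with hsJ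
    let P' := MvPolynomial {j : {j : Fin n // j ≠ i} // j ∉ sJ} (R ⧸ I)
    have hflat : RingTheory.Sequence.IsWeaklyRegular P'
        ((List.ofFn fun k => Ideal.Quotient.mk I (w k)).map (algebraMap (R ⧸ I) P')) :=
      (isRegular_ofFn_mk_w c w hz hd).toIsWeaklyRegular.of_flat
    rw [List.map_ofFn] at hflat
    -- the quotient module is the ring `P ⧸ (X '' sJ)`, isomorphic to `P'`
    have hideal : (Ideal.ofList (List.ofFn fun k => (MvPolynomial.X (jJ k) : P)) • ⊤ :
        Submodule P P) = Ideal.span (MvPolynomial.X '' sJ : Set P) := by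
      rw [smul_eq_mul, Ideal.mul_top, Ideal.ofList]
      congr 1
      ext p
      simp only [Set.mem_setOf_eq, List.mem_ofFn', Set.mem_image, hsJ, Set.mem_range]
      constructor
      · rintro ⟨k, rfl⟩
        exact ⟨jJ k, ⟨k, rfl⟩, rfl⟩
      · rintro ⟨_, ⟨k, rfl⟩, rfl⟩
        exact ⟨k, rfl⟩
    let ε : (P ⧸ Ideal.span (MvPolynomial.X '' sJ : Set P)) ≃+* P' :=
      (MvPolynomial.quotientSpanXEquiv sJ).toRingEquiv
    -- transport along `ε.symm` (as an additive equivalence compatible with the `P`-action)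
    have halg : ∀ r : R ⧸ I, (algebraMap (R ⧸ I) P') r = MvPolynomial.C r := fun r => rfl
    have hC : ∀ r : R ⧸ I, ε.symm (MvPolynomial.C r) = Ideal.Quotient.mk _ (MvPolynomial.C r) := by
      intro r
      apply ε.injective
      rw [RingEquiv.apply_symm_apply]
      exact (MvPolynomial.quotientSpanXEquiv_mk_C sJ r).symm
    have key : RingTheory.Sequence.IsWeaklyRegular
        (P ⧸ Ideal.span (MvPolynomial.X '' sJ : Set P))
        (List.ofFn fun k => (MvPolynomial.C (Ideal.Quotient.mk I (w k)) : P)) := by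
      refine (AddEquiv.isWeaklyRegular_congr (e := ε.symm.toAddEquiv)
        (as := List.ofFn fun k => (algebraMap (R ⧸ I) P') (Ideal.Quotient.mk I (w k)))
        (bs := List.ofFn fun k => (MvPolynomial.C (Ideal.Quotient.mk I (w k)) : P)) ?_).mp hflat
      rw [List.forall₂_iff_get]
      refine ⟨by simp, fun k h₁ h₂ x => ?_⟩
      simp only [List.get_eq_getElem, List.getElem_ofFn]
      change ε.symm ((algebraMap (R ⧸ I) P') (Ideal.Quotient.mk I (w ⟨k, _⟩)) * x) =
        Ideal.Quotient.mk _ (MvPolynomial.C (Ideal.Quotient.mk I (w ⟨k, _⟩)) : P) * ε.symm x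
      rw [map_mul, halg, hC]
    rw [hideal]
    exact key

end Rsop

/-! ## The local ring at a prime over the closed point: abstract chart data

To keep instance search light we work with ABSTRACT chart data: a Noetherian ring `A` with a
structure map `ψ : R → A`, elements `u_j ∈ A` with `ψ(c_j) = ψ(cᵢ) u_j`, `ψ(cᵢ)` a
non-zero-divisor, and a ring isomorphism `ε : (R/I)[T_j : j ≠ i] ≅ A/(ψ cᵢ)` with
`ε(r̄) = ψ(r)`, `ε(T_j) = u_j`; and an `A`-algebra `L` which is the localisation of `A` at a prime
`𝔓` lying over `𝔪_R`. The Rees chart `B = (R[It])_{(cᵢt)}` with `φ`, `e_j`, `chartQuotEquiv`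
is such a datum (`isRsopPart_chartFamily_reesChart` below). -/

section AbstractChart

variable [IsRegularLocalRing R] {l : ℕ} (w : Fin l → R)
  (hz : Ideal.span (Set.range (Fin.append c w)) = maximalIdeal R)
  (hd : (maximalIdeal R).spanFinrank = n + l)
  {A : Type u} [CommRing A] (L : Type u) [CommRing L] (ψ : R →+* A) (u : Fin n → A) (hnzd : ψ (c i) ∈ nonZeroDivisors A)
  (ε : MvPolynomial {j : Fin n // j ≠ i} (R ⧸ Ideal.span (Set.range c)) ≃+* A ⧸ Ideal.span {ψ (c i)})
  (hεC : ∀ r : R, ε (MvPolynomial.C (Ideal.Quotient.mk (Ideal.span (Set.range c)) r)) =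
    Ideal.Quotient.mk _ (ψ r))
  (hεX : ∀ j : {j : Fin n // j ≠ i}, ε (MvPolynomial.X j) = Ideal.Quotient.mk _ (u j.1))
  (𝔓 : Ideal A) [𝔓.IsPrime] (h𝔓 : 𝔓.comap ψ = maximalIdeal R)
  [Algebra A L] [IsLocalization.AtPrime L 𝔓]

local notation3 "KA" => Ideal.span {ψ (c i)}
local notation3 "KL" => Ideal.map (algebraMap A L) (Ideal.span {ψ (c i)})
local notation3 "Lb" => L ⧸ KL

include h𝔓 in
omit [𝔓.IsPrime] in
/-- Elements of `𝔪_R` map into `𝔓`. [folklore] -/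
theorem map_mem_of_mem_maximalIdeal {r : R} (hr : r ∈ maximalIdeal R) : ψ r ∈ 𝔓 := by
  rw [← h𝔓] at hr
  exact hr

include hz h𝔓 in
omit [𝔓.IsPrime] in
/-- `ψ(c_j) ∈ 𝔓`. [folklore] -/
theorem map_centre_mem (j : Fin n) : ψ (c j) ∈ 𝔓 :=
  map_mem_of_mem_maximalIdeal ψ 𝔓 h𝔓 (hz ▸ Ideal.subset_span ⟨Fin.castAdd l j, by simp⟩)

include hz h𝔓 in
omit [𝔓.IsPrime] in
/-- `ψ(w_k) ∈ 𝔓`. [folklore] -/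
theorem map_w_mem (k : Fin l) : ψ (w k) ∈ 𝔓 :=
  map_mem_of_mem_maximalIdeal ψ 𝔓 h𝔓 (hz ▸ Ideal.subset_span ⟨Fin.natAdd n k, by simp⟩)

/-- The `(R/I)[T]`-algebra structure on `L/(ψ cᵢ)` through `ε : (R/I)[T] ≅ A/(ψ cᵢ)` and
`A/(ψ cᵢ) → L/(ψ cᵢ)L`, in the form produced by `IsLocalization.isLocalization_of_base_ringEquiv`.
[folklore] -/
@[reducible] def quotBarAlgebra : Algebra P Lb :=
  ((algebraMap (A ⧸ KA) Lb).comp ε.symm.symm.toRingHom).toAlgebra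

omit [IsRegularLocalRing R] in
include 𝔓 in
/-- `L/(ψ cᵢ)L` is a localisation of `(R/I)[T]` (through `ε`), hence flat over it. [folklore] -/
theorem flat_quotBar :
    letI := quotBarAlgebra c i L ψ ε
    Module.Flat P Lb := by
  letI := quotBarAlgebra c i L ψ ε
  have hloc := IsLocalization.isLocalization_of_base_ringEquiv
    (Algebra.algebraMapSubmonoid (A ⧸ KA) 𝔓.primeCompl) (Lb) ε.symm
  exact @IsLocalization.flat _ (Lb) _ _ (quotBarAlgebra c i L ψ ε) _ hloc

omit [IsRegularLocalRing R] in
include hεX in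
/-- The algebra map `(R/I)[T] → L/(ψ cᵢ)L` on variables: `T_j ↦ u_j`. [folklore] -/
theorem quotBar_algebraMap_X (j : {j : Fin n // j ≠ i}) :
    letI := quotBarAlgebra c i L ψ ε
    algebraMap P Lb (MvPolynomial.X j) = Ideal.Quotient.mk KL (algebraMap A L (u j.1)) := by
  letI := quotBarAlgebra c i L ψ ε
  change (algebraMap (A ⧸ KA) Lb) (ε.symm.symm (MvPolynomial.X j)) = _
  rw [RingEquiv.symm_symm, hεX]
  rfl

omit [IsRegularLocalRing R] in
include hεC in
/-- The algebra map `(R/I)[T] → L/(ψ cᵢ)L` on constants: `r̄ ↦ ψ(r)`. [folklore] -/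
theorem quotBar_algebraMap_C (r : R) :
    letI := quotBarAlgebra c i L ψ ε
    algebraMap P Lb (MvPolynomial.C (Ideal.Quotient.mk I r)) =
      Ideal.Quotient.mk KL (algebraMap A L (ψ r)) := by
  letI := quotBarAlgebra c i L ψ ε
  change (algebraMap (A ⧸ KA) Lb) (ε.symm.symm _) = _
  rw [RingEquiv.symm_symm, hεC]
  rfl

omit [IsRegularLocalRing R] in
include hnzd 𝔓 in
/-- `ψ(cᵢ)/1` is a non-zero-divisor of `L` (images of non-zero-divisors under localisation maps
are non-zero-divisors). [folklore] -/
theorem algebraMap_centre_mem_nonZeroDivisors : algebraMap A L (ψ (c i)) ∈ nonZeroDivisors L :=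
  IsLocalization.nonZeroDivisors_le_comap 𝔓.primeCompl L hnzd

/-- **The candidate part of a regular system of parameters of `L`**:
`ζ = (ψ cᵢ, (u_{j_k})_k, (ψ w_k)_k)` (all over `1`), for an enumeration `jJ` of some of the
`j ≠ i`. [folklore] -/
def chartFamily {a : ℕ} (jJ : Fin a → {j : Fin n // j ≠ i}) : Fin (a + l + 1) → L :=
  Fin.cons (algebraMap A L (ψ (c i)))
    (Fin.append (fun k => algebraMap A L (u (jJ k).1)) fun k => algebraMap A L (ψ (w k)))

omit [IsRegularLocalRing R] in
/-- The list of `chartFamily`. [folklore] -/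
theorem ofFn_chartFamily {a : ℕ} (jJ : Fin a → {j : Fin n // j ≠ i}) :
    List.ofFn (chartFamily c i w L ψ u jJ) = algebraMap A L (ψ (c i)) ::
      ((List.ofFn fun k => algebraMap A L (u (jJ k).1)) ++
        List.ofFn fun k => algebraMap A L (ψ (w k))) := by
  rw [chartFamily, List.ofFn_cons, List.ofFn_fin_append]

include hz hd hnzd hεC hεX 𝔓 in
/-- **The chart family is a weakly regular sequence on `L`**: `ψ cᵢ` is a non-zero-divisor, and
modulo it the rest is the image, in the flat `(R/I)[T]`-algebra `L/(ψ cᵢ)L`, of the weakly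
regular sequence `(T_J, w̄)` of `isWeaklyRegular_X_append_C`. [folklore] -/
theorem isWeaklyRegular_chartFamily {a : ℕ} (jJ : Fin a → {j : Fin n // j ≠ i})
    (hjJ : Function.Injective jJ) :
    RingTheory.Sequence.IsWeaklyRegular L (List.ofFn (chartFamily c i w L ψ u jJ)) := by
  rw [ofFn_chartFamily, RingTheory.Sequence.isWeaklyRegular_cons_iff]
  constructor
  · exact Module.Flat.isSMulRegular_of_nonZeroDivisors
      (algebraMap_centre_mem_nonZeroDivisors c i L ψ hnzd 𝔓)
  · -- modulo `ψ cᵢ`: the module `QuotSMulTop` is `L/(ψ cᵢ)L`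
    letI := quotBarAlgebra c i L ψ ε
    haveI := flat_quotBar c i L ψ ε 𝔓
    have hP := isWeaklyRegular_X_append_C c i w hz hd jJ hjJ
    have hLbar := hP.of_flat (S := Lb)
    rw [List.map_append, List.map_ofFn, List.map_ofFn] at hLbar
    simp only [Function.comp_def, quotBar_algebraMap_X c i L ψ u ε hεX,
      quotBar_algebraMap_C c i L ψ ε hεC] at hLbar
    -- as an `L`-module with `L`-elements
    have hLbar' : RingTheory.Sequence.IsWeaklyRegular Lb
        ((List.ofFn fun k => algebraMap A L (u (jJ k).1)) ++
          List.ofFn fun k => algebraMap A L (ψ (w k))) := by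
      rw [← RingTheory.Sequence.isWeaklyRegular_map_algebraMap_iff Lb]
      rw [List.map_append, List.map_ofFn, List.map_ofFn]
      exact hLbar
    -- `QuotSMulTop (ψ cᵢ) L ≃ₗ[L] L/(ψ cᵢ)L`
    have hKL : (algebraMap A L (ψ (c i)) • ⊤ : Submodule L L) = (KL).restrictScalars L := by
      rw [Ideal.map_span, Set.image_singleton, ← Submodule.ideal_span_singleton_smul, smul_eq_mul,
        Ideal.mul_top]
      rfl
    let eq : QuotSMulTop (algebraMap A L (ψ (c i))) L ≃ₗ[L] Lb := Submodule.quotEquivOfEq _ _ hKL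
    exact (eq.isWeaklyRegular_congr _).mpr hLbar'


/-! ## The chart family is a regular sequence; dimension count -/

include hz h𝔓 in
/-- All members of the chart family lie in the maximal ideal of `L`. [folklore] -/
theorem chartFamily_mem_maximalIdeal [IsLocalRing L] {a : ℕ} (jJ : Fin a → {j : Fin n // j ≠ i})
    (hJ : ∀ k, u (jJ k).1 ∈ 𝔓) (k : Fin (a + l + 1)) :
    chartFamily c i w L ψ u jJ k ∈ maximalIdeal L := by
  have hmem : ∀ a' ∈ 𝔓, algebraMap A L a' ∈ maximalIdeal L := fun a' ha' =>
    (IsLocalization.AtPrime.to_map_mem_maximal_iff L 𝔓 a').mpr ha'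
  refine Fin.cases ?_ (fun k => ?_) k
  · exact hmem _ (map_centre_mem c w hz ψ 𝔓 h𝔓 i)
  · simp only [chartFamily, Fin.cons_succ]
    refine Fin.addCases (fun k => ?_) (fun k => ?_) k
    · rw [Fin.append_left]
      exact hmem _ (hJ k)
    · rw [Fin.append_right]
      exact hmem _ (map_w_mem c w hz ψ 𝔓 h𝔓 k)

/-- `Ideal.ofList (List.ofFn f)` is the ideal generated by the range of `f`. [folklore] -/
theorem Ideal.ofList_ofFn {S : Type*} [CommSemiring S] {m : ℕ} (f : Fin m → S) :
    Ideal.ofList (List.ofFn f) = Ideal.span (Set.range f) :=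
  congr_arg Ideal.span (Set.ext fun x => by rw [Set.mem_setOf_eq, List.mem_ofFn'])

include hz h𝔓 in
/-- The ideal of the chart family is a proper ideal of `L`. [folklore] -/
theorem ofList_chartFamily_ne_top {a : ℕ} (jJ : Fin a → {j : Fin n // j ≠ i})
    (hJ : ∀ k, u (jJ k).1 ∈ 𝔓) : Ideal.ofList (List.ofFn (chartFamily c i w L ψ u jJ)) ≠ ⊤ := by
  haveI := IsLocalization.AtPrime.isLocalRing L 𝔓
  refine fun h => (maximalIdeal.isMaximal L).ne_top (top_le_iff.mp ?_)
  rw [← h, Ideal.ofList_ofFn, Ideal.span_le]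
  rintro _ ⟨k, rfl⟩
  exact chartFamily_mem_maximalIdeal c i w hz L ψ u 𝔓 h𝔓 jJ hJ k

include hz hd hnzd hεC hεX h𝔓 in
/-- **The chart family is a regular sequence on `L`.** [folklore] -/
theorem isRegular_chartFamily {a : ℕ} (jJ : Fin a → {j : Fin n // j ≠ i})
    (hjJ : Function.Injective jJ) (hJ : ∀ k, u (jJ k).1 ∈ 𝔓) :
    RingTheory.Sequence.IsRegular L (List.ofFn (chartFamily c i w L ψ u jJ)) := by
  refine ⟨isWeaklyRegular_chartFamily c i w hz hd L ψ u hnzd ε hεC hεX 𝔓 jJ hjJ, ?_⟩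
  rw [smul_eq_mul, Ideal.mul_top]
  exact (ofList_chartFamily_ne_top c i w hz L ψ u 𝔓 h𝔓 jJ hJ).symm

include hz hd hnzd hεC hεX h𝔓 in
/-- **Dimension count**: `dim L/(ζ) + |ζ| = dim L` for the chart family `ζ` (a regular
sequence in the Noetherian local ring `L`). [cite: Matsumura1987, Thm. 17.4] -/
theorem ringKrullDim_quot_chartFamily_add [IsNoetherianRing A] {a : ℕ} (jJ : Fin a → {j : Fin n // j ≠ i})
    (hjJ : Function.Injective jJ) (hJ : ∀ k, u (jJ k).1 ∈ 𝔓) :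
    ringKrullDim (L ⧸ Ideal.span (Set.range (chartFamily c i w L ψ u jJ))) + (a + l + 1 : ℕ) =
      ringKrullDim L := by
  haveI := IsLocalization.AtPrime.isLocalRing L 𝔓
  haveI : IsNoetherianRing L := IsLocalization.isNoetherianRing 𝔓.primeCompl L inferInstance
  have h := Module.supportDim_add_length_eq_supportDim_of_isRegular (M := L) _
    (isRegular_chartFamily c i w hz hd L ψ u hnzd ε hεC hεX 𝔓 h𝔓 jJ hjJ hJ)
  rw [List.length_ofFn, Module.supportDim_self_eq_ringKrullDim] at h
  rw [← h, ← Module.supportDim_quotient_eq_ringKrullDim]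
  congr 1
  refine Module.supportDim_eq_of_equiv (Submodule.quotEquivOfEq _ _ ?_)
  rw [smul_eq_mul, Ideal.mul_top, Ideal.ofList_ofFn]

/-! ## The quotient by the chart family is regular -/

/-- **`L/K₀L` is a regular local ring if `A/K₀` is a regular ring** (`K₀ ⊆ 𝔓`): it is the
localisation of `A/K₀` at the prime `𝔓/K₀`. [cite: Matsumura1987, Thm. 19.3] -/
theorem isRegularLocalRing_quot_map_of_isRegularRing (K₀ : Ideal A) (hK : K₀ ≤ 𝔓)
    [IsRegularRing (A ⧸ K₀)] : IsRegularLocalRing (L ⧸ K₀.map (algebraMap A L)) := by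
  set pbar : Ideal (A ⧸ K₀) := 𝔓.map (Ideal.Quotient.mk K₀) with hpbar
  have hcomap : pbar.comap (Ideal.Quotient.mk K₀) = 𝔓 := by
    rw [hpbar, Ideal.comap_map_of_surjective _ Ideal.Quotient.mk_surjective,
      ← RingHom.ker_eq_comap_bot, Ideal.mk_ker, sup_eq_left]
    exact hK
  haveI hpbarp : pbar.IsPrime :=
    Ideal.map_isPrime_of_surjective Ideal.Quotient.mk_surjective (by rwa [Ideal.mk_ker])
  have hmem : ∀ x : A, Ideal.Quotient.mk K₀ x ∈ pbar ↔ x ∈ 𝔓 := fun x => by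
    rw [← Ideal.mem_comap, hcomap]
  have hM : Algebra.algebraMapSubmonoid (A ⧸ K₀) 𝔓.primeCompl = pbar.primeCompl := by
    ext b
    constructor
    · rintro ⟨x, hx, rfl⟩
      exact fun h => hx ((hmem x).mp h)
    · intro hb
      obtain ⟨x, rfl⟩ := Ideal.Quotient.mk_surjective b
      exact ⟨x, fun h => hb ((hmem x).mpr h), rfl⟩
  haveI : IsLocalization.AtPrime (L ⧸ K₀.map (algebraMap A L)) pbar := by
    have := (inferInstance : IsLocalization (Algebra.algebraMapSubmonoid (A ⧸ K₀) 𝔓.primeCompl)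
      (L ⧸ K₀.map (algebraMap A L)))
    rwa [hM] at this
  exact IsRegularLocalRing.of_ringEquiv (IsLocalization.algEquiv pbar.primeCompl
    (Localization.AtPrime pbar) (L ⧸ K₀.map (algebraMap A L))).toRingEquiv

include hz hd hεC hεX in
/-- **`A/K₀` is a regular ring** for `K₀ = (ψ cᵢ, u_J, ψ w)`: through `ε`,
`A/K₀ ≅ (R/I)[T_j : j ≠ i]/(T_J, w̄) ≅ (R/𝔪)[T_j : j ∉ J]`, a polynomial ring over a field.
[folklore] -/
theorem isRegularRing_quot_chartIdeal {a : ℕ} (jJ : Fin a → {j : Fin n // j ≠ i}) :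
    IsRegularRing (A ⧸ Ideal.ofList (ψ (c i) ::
      ((List.ofFn fun k => u (jJ k).1) ++ List.ofFn fun k => ψ (w k)))) := by
  classical
  haveI := isRegularLocalRing_quot_centre c w hz hd
  -- the residue field `(R/I)/𝔪'`
  set 𝔪' : Ideal (R ⧸ I) := Ideal.ofList (List.ofFn fun k => Ideal.Quotient.mk I (w k)) with h𝔪'
  have h𝔪'max : 𝔪' = maximalIdeal (R ⧸ I) := ofList_ofFn_mk_w c w hz
  haveI : 𝔪'.IsMaximal := h𝔪'max ▸ maximalIdeal.isMaximal _
  letI := Ideal.Quotient.field 𝔪'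
  set sJ : Set {j : Fin n // j ≠ i} := Set.range jJ with hsJ
  -- the ideals along the way
  set K₁ : Ideal P := Ideal.ofList ((List.ofFn fun k => MvPolynomial.X (jJ k)) ++
    List.ofFn fun k => MvPolynomial.C (Ideal.Quotient.mk I (w k))) with hK₁
  have hK₁eq : K₁ = Ideal.span (MvPolynomial.X '' sJ : Set P) ⊔ 𝔪'.map MvPolynomial.C := by
    rw [hK₁, Ideal.ofList_append]
    congr 1
    · rw [Ideal.ofList_ofFn, hsJ, ← Set.range_comp]
      rfl
    · rw [h𝔪', Ideal.map_ofList, List.map_ofFn]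
      rfl
  -- Step 5: polynomial ring over the residue field
  have e5 : MvPolynomial {j : {j : Fin n // j ≠ i} // j ∉ sJ} ((R ⧸ I) ⧸ 𝔪') ≃+*
      MvPolynomial {j : {j : Fin n // j ≠ i} // j ∉ sJ} (R ⧸ I) ⧸
        (𝔪'.map MvPolynomial.C : Ideal (MvPolynomial {j : {j : Fin n // j ≠ i} // j ∉ sJ} (R ⧸ I))) :=
    (MvPolynomial.quotientEquivQuotientMvPolynomial 𝔪').toRingEquiv
  -- Step 4: killing the variables `T_J`
  have e4 : (P ⧸ Ideal.span (MvPolynomial.X '' sJ : Set P)) ⧸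
      (𝔪'.map MvPolynomial.C : Ideal P).map (Ideal.Quotient.mk _) ≃+*
        MvPolynomial {j : {j : Fin n // j ≠ i} // j ∉ sJ} (R ⧸ I) ⧸
          (𝔪'.map MvPolynomial.C :
            Ideal (MvPolynomial {j : {j : Fin n // j ≠ i} // j ∉ sJ} (R ⧸ I))) :=
    Ideal.quotientEquiv _ _ (AlgEquiv.toRingEquiv (MvPolynomial.quotientSpanXEquiv sJ)) (by
      rw [Ideal.map_map, Ideal.map_map]
      congr 1
      refine RingHom.ext fun x => ?_
      simp only [RingHom.comp_apply]
      exact (MvPolynomial.quotientSpanXEquiv_mk_C sJ x).symm)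
  -- Step 3: double quotient
  have e3 : P ⧸ K₁ ≃+* (P ⧸ Ideal.span (MvPolynomial.X '' sJ : Set P)) ⧸
      (𝔪'.map MvPolynomial.C : Ideal P).map (Ideal.Quotient.mk _) :=
    (Ideal.quotEquivOfEq hK₁eq).trans (DoubleQuot.quotQuotEquivQuotSup _ _).symm
  -- Step 2: through `ε`
  have hK₀ : (Ideal.ofList (ψ (c i) :: ((List.ofFn fun k => u (jJ k).1) ++
      List.ofFn fun k => ψ (w k)))).map (Ideal.Quotient.mk KA) = K₁.map (ε : P →+* A ⧸ KA) := by
    have h0 : Ideal.span {Ideal.Quotient.mk KA (ψ (c i))} = ⊥ :=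
      Ideal.span_singleton_eq_bot.mpr (Ideal.Quotient.eq_zero_iff_mem.mpr
        (Ideal.subset_span rfl))
    rw [Ideal.map_ofList, List.map_cons, Ideal.ofList_cons, h0, bot_sup_eq, hK₁, Ideal.map_ofList,
      List.map_append, List.map_append, List.map_ofFn, List.map_ofFn, List.map_ofFn, List.map_ofFn]
    have h1 : (⇑(Ideal.Quotient.mk KA) ∘ fun k => u (jJ k).1) =
        (⇑(ε : P →+* A ⧸ KA) ∘ fun k => MvPolynomial.X (jJ k)) :=
      funext fun k => by simp only [Function.comp_apply, RingHom.coe_coe, hεX]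
    have h2 : (⇑(Ideal.Quotient.mk KA) ∘ fun k => ψ (w k)) =
        (⇑(ε : P →+* A ⧸ KA) ∘ fun k => MvPolynomial.C (Ideal.Quotient.mk I (w k))) :=
      funext fun k => by simp only [Function.comp_apply, RingHom.coe_coe, hεC]
    rw [h1, h2]
  have e2 : (A ⧸ KA) ⧸ (Ideal.ofList (ψ (c i) :: ((List.ofFn fun k => u (jJ k).1) ++
      List.ofFn fun k => ψ (w k)))).map (Ideal.Quotient.mk KA) ≃+* P ⧸ K₁ :=
    (Ideal.quotientEquiv K₁ _ ε hK₀).symm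
  -- Step 1
  have hle : KA ≤ Ideal.ofList (ψ (c i) :: ((List.ofFn fun k => u (jJ k).1) ++
      List.ofFn fun k => ψ (w k))) := by
    rw [Ideal.ofList_cons]
    exact le_sup_left
  have e1 := (DoubleQuot.quotQuotEquivQuotOfLE hle).symm
  haveI : IsRegularRing (MvPolynomial {j : {j : Fin n // j ≠ i} // j ∉ sJ} ((R ⧸ I) ⧸ 𝔪')) :=
    inferInstance
  exact IsRegularRing.of_ringEquiv
    (e5.trans (e4.symm.trans (e3.symm.trans (e2.symm.trans e1.symm))))

/-! ## Main theorem -/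

omit [IsRegularLocalRing R] in
/-- The ideal of the chart family is the extension of `K₀ = (ψ cᵢ, u_J, ψ w) ⊆ A`. [folklore] -/
theorem span_range_chartFamily {a : ℕ} (jJ : Fin a → {j : Fin n // j ≠ i}) :
    Ideal.span (Set.range (chartFamily c i w L ψ u jJ)) = (Ideal.ofList (ψ (c i) ::
      ((List.ofFn fun k => u (jJ k).1) ++ List.ofFn fun k => ψ (w k)))).map (algebraMap A L) := by
  rw [← Ideal.ofList_ofFn, ofFn_chartFamily, Ideal.map_ofList, List.map_cons, List.map_append,
    List.map_ofFn, List.map_ofFn]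
  rfl

include hz hd hnzd hεC hεX h𝔓 in
/-- **Main theorem (abstract chart).** For a prime `𝔓 ⊂ A` over `𝔪_R` and any enumeration
`jJ` of indices `j ≠ i` with `u_j ∈ 𝔓`, the family `(ψ cᵢ, (u_{jJ k})_k, (ψ w_k)_k)` is part of a
regular system of parameters of `L = A_𝔓`; in particular `L` is a regular local ring.
[cite: DeJong1996, 2.4 with 4.26–4.27] [cite: StacksProject, Tag 0BIQ] -/
theorem isRsopPart_chartFamily [IsNoetherianRing A] [IsLocalRing L] {a : ℕ} (jJ : Fin a → {j : Fin n // j ≠ i})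
    (hjJ : Function.Injective jJ) (hJ : ∀ k, u (jJ k).1 ∈ 𝔓) :
    IsRsopPart (chartFamily c i w L ψ u jJ) := by
  haveI : IsNoetherianRing L := IsLocalization.isNoetherianRing 𝔓.primeCompl L inferInstance
  have hK₀𝔓 : Ideal.ofList (ψ (c i) :: ((List.ofFn fun k => u (jJ k).1) ++
      List.ofFn fun k => ψ (w k))) ≤ 𝔓 := by
    rw [Ideal.ofList, Ideal.span_le]
    intro x hx
    simp only [Set.mem_setOf_eq, List.mem_cons, List.mem_append, List.mem_ofFn] at hx
    rcases hx with rfl | ⟨k, rfl⟩ | ⟨k, rfl⟩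
    · exact map_centre_mem c w hz ψ 𝔓 h𝔓 i
    · exact hJ k
    · exact map_w_mem c w hz ψ 𝔓 h𝔓 k
  haveI := isRegularRing_quot_chartIdeal c i w hz hd ψ u ε hεC hεX jJ
  haveI hreg : IsRegularLocalRing (L ⧸ Ideal.span (Set.range (chartFamily c i w L ψ u jJ))) := by
    rw [span_range_chartFamily]
    exact isRegularLocalRing_quot_map_of_isRegularRing L 𝔓 _ hK₀𝔓
  refine IsRsopPart.of_isRegularLocalRing_quotient
    (chartFamily_mem_maximalIdeal c i w hz L ψ u 𝔓 h𝔓 jJ hJ) ?_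
  exact (ringKrullDim_quot_chartFamily_add c i w hz hd L ψ u hnzd ε hεC hεX 𝔓 h𝔓 jJ hjJ hJ).le

include hz hd hnzd hεC hεX h𝔓 in
/-- In particular **`L` is a regular local ring**. [cite: DeJong1996, 2.4] -/
theorem isRegularLocalRing_chart [IsNoetherianRing A] [IsLocalRing L] : IsRegularLocalRing L :=
  (isRsopPart_chartFamily c i w hz hd L ψ u hnzd ε hεC hεX 𝔓 h𝔓 (a := 0)
    (fun k => Fin.elim0 k) (Function.injective_of_subsingleton _) fun k => Fin.elim0 k).1

end AbstractChart

/-! ## The Rees chart is an abstract chart datum -/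

/-- **Main theorem for the chart `D₊(cᵢ t)` of `Bl_{(c)} Spec R`**, `R` regular local with regular
system of parameters `(c, w)`: at a prime `𝔓` of `B = (R[It])_{(cᵢt)}` over `𝔪_R`, the family
`(cᵢ, (e_{jJ k})_k, (w_k)_k)` (any injective enumeration `jJ` of indices `j ≠ i` with `e_j ∈ 𝔓`)
is part of a regular system of parameters of any localisation `L` of `B` at `𝔓`.
[cite: DeJong1996, 2.4 with 4.26–4.27] [cite: StacksProject, Tag 0BIQ] -/
theorem isRsopPart_chartFamily_reesChart [IsRegularLocalRing R] {l : ℕ} (w : Fin l → R)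
    (hz : Ideal.span (Set.range (Fin.append c w)) = maximalIdeal R)
    (hd : (maximalIdeal R).spanFinrank = n + l)
    (𝔓 : Ideal (chartRing c i)) [𝔓.IsPrime] (h𝔓 : 𝔓.comap (chartBase c i) = maximalIdeal R)
    (L : Type u) [CommRing L] [IsLocalRing L] [Algebra (chartRing c i) L]
    [IsLocalization.AtPrime L 𝔓] {a : ℕ} (jJ : Fin a → {j : Fin n // j ≠ i})
    (hjJ : Function.Injective jJ) (hJ : ∀ k, chartGen c i (jJ k).1 ∈ 𝔓) :
    IsRsopPart (chartFamily c i w L (chartBase c i) (chartGen c i) jJ) := by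
  haveI : IsNoetherianRing (chartRing c i) := isNoetherianRing_blowupChart c i
  exact isRsopPart_chartFamily c i w hz hd L (chartBase c i) (chartGen c i)
    (reesChartBase_mem_nonZeroDivisors (c i) (Ideal.mem_span_range_self (f := c) (x := i)))
    (chartQuotEquiv c i (isQuasiRegular_centre c w hz hd)) (chartQuotMap_C c i)
    (chartQuotMap_X c i) 𝔓 h𝔓 jJ hjJ hJ


end Literature.AlgebraicGeometry.Resolution

end
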